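import Summits.BirchSwinnertonDyer.BirchSwinnertonDyer.Theorems.Rank1ResidualPartitionGrid
import Literature.NumberTheory.EllipticCurves.Rank1Residual.Typed.X6
import Literature.NumberTheory.EllipticCurves.Rank1Residual.Typed.X7
import Literature.NumberTheory.EllipticCurves.Rank1Residual.Typed.X8
import Literature.NumberTheory.EllipticCurves.Rank1Residual.X9SmallImage
import Literature.NumberTheory.EllipticCurves.NonEisensteinPrimeOfSurjective
import Literature.NumberTheory.EllipticCurves.Rank1Residual.X10Proofs
import Literature.NumberTheory.EllipticCurves.Rank1Residual.EisensteinGoodComplement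
import Literature.NumberTheory.EllipticCurves.BurungaleCastellaSkinner2025.PPartBSD

set_option linter.dupNamespace false
set_option autoImplicit false

/-!
# Rank-≤ 1 residual PARTITION, part 2/3 — binding the grid to curves

`cellOf W p` computes the cell of a pair (classically; total, so every pair has exactly one cell —
acceptance point 3); the atom lemmas `cellOf_…` say each coordinate means its `Predicates`
proposition (reduction type total: `Good ∧ p ∤ a_p` / `Good ∧ p ∣ a_p` / `¬Good ∧ Mult` / `Addv`;
CM-prime trichotomy `CMSplit` / `CMRamified ∧ ¬CMSplit` / `CMInert`).
`holds_of_spec` is the per-cell BINDING lemma (acceptance point 2): if the cell of a pair of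
analytic rank `≤ 1` meets a target's `spec`, the target holds IN ITS REAL MEANING — for a covering
row the printed hypotheses of the cited theorem as an explicit conjunction over the `Predicates`
vocabulary (row C2's is literally the binder list of `BurungaleCastellaSkinner2025.bsdp_of_cor131`,
row C16's that of `Rank1Residual.bsdp_of_goodOrd_irr_bigIm`), for a class the predicate
`ClassXi W p` ITSELF (no re-typing), for `newFormerC4` the former-C4 conjunction, for
`emptyLitSerre` the configuration `5 ≤ p ∧ Surj ∧ ¬BigIm`, and `False` for the six tree-empty
targets and `gap`. The six tree theorems enter exactly there (`goodOrd_of_anom`; `Semistable`;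
`hasIrreducibleModPGaloisRep_of_hasSurjectiveModNGaloisRep`; `not_bigIm_of_irr_of_not_surj`;
`hasIrreducibleModPGaloisRep_of_dvd_frobeniusTrace` = the proof term of `ClassX6/7/8.not_red`;
`hasSurjectiveModNGaloisRep_of_hasIrreducibleModPGaloisRep_of_isSemistable` = that of
`ClassX6.surj` / `ClassX8.surj_of_semistable` — reused, not re-proved, acceptance point 6).
No `Prop`-valued constant is defined (no named fact, no new predicate). HOME/PARTITION.md.
-/

noncomputable section

open scoped Classical

open WeierstrassCurve Literature.NumberTheory.EllipticCurves
  Literature.NumberTheory.EllipticCurves.ModularForms Literature.NumberTheory.EllipticCurves.Rank1Residual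

namespace Summit.BirchSwinnertonDyer.BirchSwinnertonDyer.Rank1Residual.Partition

variable (W : WeierstrassCurve ℚ) [W.IsElliptic] [W.IsGloballyMinimal] (p : ℕ) [Fact p.Prime]

/-- The cell of a pair `(E, p)` (classical: every atom is a decided proposition). -/
def cellOf : Cell where
  r := if W.analyticRank = 0 then .r0 else .r1
  pc := if p = 2 then .p2 else if p = 3 then .p3 else .p5
  red := if Good W p then (if (p : ℤ) ∣ W.frobeniusTrace p then .ss else .ord)
    else if Mult W p then .mult else .add
  irr := decide (Irr W p)
  surj := decide (Surj W p)
  im := decide (BigIm W p)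
  cm := decide W.HasCM
  pK := if CMSplit W p then .split else if CMRamified W p then .ram else .inert
  sst := decide (Semistable W)
  ram := decide (Ram W p)
  anom := decide (Anom W p)
  gvpar := decide (GVPar W p)
  a3z := decide (W.frobeniusTrace 3 = 0)

/-! ### Atom lemmas (acceptance point 3: the coordinates are total and mean what they say) -/

/-- Atom `r0` means analytic rank `0`. -/
theorem cellOf_r_is0 : (cellOf W p).r.is0 = true ↔ W.analyticRank = 0 := by
  simp only [cellOf]; split_ifs <;> simp_all [Rk.is0]

/-- Atom `r1` means analytic rank `≠ 0` (so `= 1` under `r_an ≤ 1`). -/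
theorem cellOf_r_is1 : (cellOf W p).r.is1 = true ↔ W.analyticRank ≠ 0 := by
  simp only [cellOf]; split_ifs <;> simp_all [Rk.is1]

/-- Atom `p2` means `p = 2`. -/
theorem cellOf_pc_is2 : (cellOf W p).pc.is2 = true ↔ p = 2 := by
  simp only [cellOf]; split_ifs <;> simp_all [PC.is2]

/-- Atom `p3` means `p = 3`. -/
theorem cellOf_pc_is3 : (cellOf W p).pc.is3 = true ↔ p = 3 := by
  simp only [cellOf]; split_ifs <;> simp_all [PC.is3]

/-- Atom `p5` means `5 ≤ p` (`p` prime, `p ≠ 2, 3`). -/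
theorem cellOf_pc_is5 : (cellOf W p).pc.is5 = true ↔ 5 ≤ p := by
  have hp : p.Prime := Fact.out
  simp only [cellOf]; split_ifs with h2 h3
  · simp [PC.is5, h2]
  · simp [PC.is5, h3]
  · simp only [PC.is5, true_iff]
    exact hp.five_le_of_ne_two_of_ne_three h2 h3

/-- Atom `odd` means `p ≠ 2`. -/
theorem cellOf_pc_odd : (cellOf W p).pc.odd = true ↔ p ≠ 2 := by
  simp only [cellOf]; split_ifs <;> simp_all [PC.odd]

/-- Atom `ord` means good ordinary reduction at `p` (`GoodOrd`). -/
theorem cellOf_red_isOrd : (cellOf W p).red.isOrd = true ↔ GoodOrd W p := by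
  simp only [cellOf]; split_ifs <;> simp_all [Rt.isOrd, GoodOrd, Good]

/-- Atom `ss` means good non-ordinary reduction at `p` (`GoodSS`). -/
theorem cellOf_red_isSS : (cellOf W p).red.isSS = true ↔ GoodSS W p := by
  simp only [cellOf]; split_ifs <;> simp_all [Rt.isSS, GoodSS, Good]

/-- Atoms `ord ∨ ss` mean good reduction at `p` (`Good`). -/
theorem cellOf_red_isGood : (cellOf W p).red.isGood = true ↔ Good W p := by
  simp only [cellOf]; split_ifs <;> simp_all [Rt.isGood]

/-- Atom `mult` means bad multiplicative reduction at `p`. -/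
theorem cellOf_red_isMult : (cellOf W p).red.isMult = true ↔ ¬ Good W p ∧ Mult W p := by
  simp only [cellOf]; split_ifs <;> simp_all [Rt.isMult]

/-- Atom `add` means additive reduction at `p` (`Addv`). -/
theorem cellOf_red_isAdd : (cellOf W p).red.isAdd = true ↔ Addv W p := by
  simp only [cellOf]; split_ifs <;> simp_all [Rt.isAdd, Addv, Good, Mult]

/- The Boolean atoms `irr surj cm sst ram anom gvpar` mean their predicates DEFINITIONALLY:
`(cellOf W p).cm = decide W.HasCM` is `rfl`; the `= true ↔` forms are `decide_eq_true_iff` and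
print-identical to the landed `Summit.BirchSwinnertonDyer.Rank1Residual.cellOf_*` of the other
partition formalization in the tree (lit seat, `Rank1Residual/Partition/CellOf.lean`), so they
are not restated here (gate dedup); `holds_of_spec` unfolds them by `rfl` equations. -/

/-- Atom `im` means `BigIm W p` (hypothesis (im)). -/
theorem cellOf_im : (cellOf W p).im = true ↔ BigIm W p := by simp [cellOf]
/-- Atom `a3z` means `a_3 = 0`. -/
theorem cellOf_a3z : (cellOf W p).a3z = true ↔ W.frobeniusTrace 3 = 0 := by simp [cellOf]

/-- Atom `split` means `CMSplit W p`. -/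
theorem cellOf_pK_isSplit : (cellOf W p).pK.isSplit = true ↔ CMSplit W p := by
  simp only [cellOf]; split_ifs <;> simp_all [PK.isSplit]

/-- Atom `ram` (CM prime type) means `CMRamified W p ∧ ¬ CMSplit W p`. -/
theorem cellOf_pK_isRam : (cellOf W p).pK.isRam = true ↔ CMRamified W p ∧ ¬ CMSplit W p := by
  simp only [cellOf]; split_ifs <;> simp_all [PK.isRam]

/-- Atom `inert` means `CMInert W p`. -/
theorem cellOf_pK_isInert : (cellOf W p).pK.isInert = true ↔ CMInert W p := by
  simp only [cellOf]; split_ifs <;> simp_all [PK.isInert, CMInert]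

/-! ### The meaning of a target on a real pair -/

variable {W p}

omit [W.IsElliptic] [W.IsGloballyMinimal] in
/-- A semistable curve is not additive at `p` (unfolding of `Semistable`). [folklore] -/
theorem not_addv_of_semistable (h : Semistable W) : ¬ Addv W p := by
  intro ha
  rcases h p Fact.out with hg | hm
  · exact ha.1 hg
  · exact ha.2 hm

/-- Good supersingular at an odd `p` ⇒ `E[p]` irreducible — the proof term of `ClassX6.irr` /
`ClassX7.irr` / `ClassX8.irr` (Serre 1972 §1.11 Prop. 12, tree theorem
`hasIrreducibleModPGaloisRep_of_dvd_frobeniusTrace`); reused, not re-proved. [folklore] -/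
theorem irr_of_goodSS (hp : p ≠ 2) (h : GoodSS W p) : Irr W p :=
  hasIrreducibleModPGaloisRep_of_dvd_frobeniusTrace W p hp
    (W.not_dvd_minimalDiscriminantInt_of_hasGoodReductionAtPrime' p h.1) h.2

/-- Semistable with `E[p]` irreducible ⇒ `ρ̄_{E,p}` surjective — the proof term of `ClassX6.surj` /
`ClassX8.surj_of_semistable` (Serre 1972 §5.4 Prop. 21 i), tree theorem
`hasSurjectiveModNGaloisRep_of_hasIrreducibleModPGaloisRep_of_isSemistable`). [folklore] -/
theorem surj_of_semistable_of_irr (hsst : Semistable W) (hirr : Irr W p) : Surj W p :=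
  W.hasSurjectiveModNGaloisRep_of_hasIrreducibleModPGaloisRep_of_isSemistable
    ((semistable_iff_isSemistable_ringOfIntegers W).mp hsst) p hirr

/-- **The per-cell binding lemma** (acceptance point 2): for a pair of analytic rank `≤ 1` whose
cell satisfies a target's `spec`, that target HOLDS IN ITS REAL MEANING — for a covering row, the
printed hypotheses of the cited theorem (RESIDUAL-CASES §a.1; C1 Skinner 2016 Thm C / Skinner–Urban
2014 Thm 2(a); C2 Burungale–Castella–Skinner 2025 Cor. 1.3.1; C3 Jetchev–Skinner–Wan 2017 Thm 1.2.1;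
C6 Castella–Grossi–Skinner 2025 Thm 4; C7 Greenberg–Vatsal 2000 + Kato + Greenberg 1999; C8
Burungale–Flach 2024 Cor. 2; C9 Rubin 1991; C10 Kobayashi 2013 Cor. 1.4; C16 Yan–Zhu 2026 Thm 4.15;
C17 Li–Liu–Tian 2024 Thm 1.1(i)); for a class, the class predicate of `Predicates.lean` itself (no re-typing);
for the new region, the former-C4 conjunction; for the Serre region, its configuration; `False` for the six
tree-empty targets and for `gap`. Tree theorems used: `goodOrd_of_anom` (emptyAnom), the unfolding
of `Semistable` (emptySstAdd), `hasIrreducibleModPGaloisRep_of_hasSurjectiveModNGaloisRep`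
(emptySurjRed), `not_bigIm_of_irr_of_not_surj` (emptySmallIm), the proof term of `ClassX6.not_red` /
`ClassX7.not_red` / `ClassX8.not_red` = `hasIrreducibleModPGaloisRep_of_dvd_frobeniusTrace`
(emptySsRed), and of `ClassX6.surj` / `ClassX8.surj_of_semistable` =
`hasSurjectiveModNGaloisRep_of_hasIrreducibleModPGaloisRep_of_isSemistable` (emptySstIrrNonsurj). -/
theorem holds_of_spec (hr : W.analyticRank ≤ 1) (t : Target) (h : spec t (cellOf W p) = true) :
    (match (generalizing := false) t with
      | .emptyAnom | .emptySstAdd | .emptySurjRed | .emptySmallIm | .emptySsRed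
      | .emptySstIrrNonsurj | .gap => False
      | .C8 => W.HasCM ∧ W.analyticRank = 0
      | .C17 => W.HasCM ∧ W.analyticRank = 1 ∧ p ≠ 2 ∧ CMSplit W p
      | .C9 => W.HasCM ∧ W.analyticRank = 1 ∧ p ≠ 2 ∧ CMSplit W p ∧ Good W p
      | .C10 => W.HasCM ∧ W.analyticRank = 1 ∧ p ≠ 2 ∧ CMInert W p ∧ Good W p
      | .X12 => ClassX12 W p
      | .X5 => ClassX5 W p
      | .C1 => W.analyticRank = 0 ∧ 3 ≤ p ∧ (GoodOrd W p ∨ Mult W p) ∧ Irr W p ∧ Ram W p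
      | .C2 => ¬ W.HasCM ∧ 3 < p ∧ GoodOrd W p ∧ Irr W p ∧ BigIm W p ∧ W.analyticRank ≤ 1
      | .C16 => ¬ W.HasCM ∧ 3 ≤ p ∧ GoodOrd W p ∧ Irr W p ∧ BigIm W p ∧ W.analyticRank ≤ 1
      | .C3 => W.analyticRank = 1 ∧ Semistable W ∧ Good W p ∧ Irr W p ∧
          (5 ≤ p ∨ (p = 3 ∧ (GoodOrd W p ∨ W.frobeniusTrace 3 = 0)))
      | .C6 => 2 < p ∧ Red W p ∧ Good W p ∧ ¬ Anom W p ∧ W.analyticRank ≤ 1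
      | .C7 => W.analyticRank = 0 ∧ ¬ W.HasCM ∧ p ≠ 2 ∧ GoodOrd W p ∧ Red W p ∧ GVPar W p
      | .X3 => ClassX3 W p
      | .X4 => ClassX4 W p
      | .X2 => ClassX2 W p
      | .X1 => ClassX1 W p
      | .X8 => ClassX8 W p
      | .X7 => ClassX7 W p
      | .X6 => ClassX6 W p
      | .X9 => ClassX9 W p
      | .X10 => ClassX10 W p
      | .X11 => ClassX11 W p
      | .newFormerC4 => W.analyticRank = 1 ∧ Mult W p ∧ Irr W p ∧ Semistable W ∧ Ram W p ∧ 5 ≤ p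
      | .emptyLitSerre => 5 ≤ p ∧ Surj W p ∧ ¬ BigIm W p) := by
  have hp : p.Prime := Fact.out
  have h2le : 2 ≤ p := hp.two_le
  have hr1 : W.analyticRank ≠ 0 → W.analyticRank = 1 := fun h0 => by omega
  -- the seven definitional Boolean atoms (note after `cellOf_red_isAdd`), as `rfl` equations
  have e_irr : (cellOf W p).irr = decide (Irr W p) := rfl
  have e_surj : (cellOf W p).surj = decide (Surj W p) := rfl
  have e_cm : (cellOf W p).cm = decide W.HasCM := rfl
  have e_sst : (cellOf W p).sst = decide (Semistable W) := rfl
  have e_ram : (cellOf W p).ram = decide (Ram W p) := rfl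
  have e_anom : (cellOf W p).anom = decide (Anom W p) := rfl
  have e_gvpar : (cellOf W p).gvpar = decide (GVPar W p) := rfl
  -- (`decide_eq_true_eq` then turns `decide P = true` into `P` in the simp set below)
  cases t <;>
    simp only [spec, Bool.and_eq_true, Bool.or_eq_true, Bool.not_eq_true', Bool.eq_false_iff,
      ne_eq, Bool.false_eq_true, and_assoc, or_assoc, cellOf_r_is0, cellOf_r_is1, cellOf_pc_is2,
      cellOf_pc_is3, cellOf_pc_is5, cellOf_pc_odd, cellOf_red_isOrd, cellOf_red_isSS,
      cellOf_red_isGood, cellOf_red_isMult, cellOf_red_isAdd, e_irr, e_surj, cellOf_im,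
      e_cm, e_sst, e_ram, e_anom, e_gvpar, decide_eq_true_eq, cellOf_a3z, cellOf_pK_isSplit,
      cellOf_pK_isRam, cellOf_pK_isInert] at h <;>
    simp only [ClassX1, ClassX2, ClassX3, ClassX4, ClassX5, ClassX6, ClassX7, ClassX8, ClassX9,
      ClassX10, ClassX11, ClassX12]
  -- emptyAnom: anom ∧ (irr ∨ ¬ord) contradicts `Anom.1` / `goodOrd_of_anom`
  · obtain ⟨ha, hi | ho⟩ := h
    · exact ha.1 hi
    · exact ho (goodOrd_of_anom W p ha)
  -- emptySstAdd: sst ∧ add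
  · obtain ⟨hs, ha⟩ := h
    exact not_addv_of_semistable hs ha
  -- emptySurjRed: surj ∧ ¬irr
  · obtain ⟨hs, hi⟩ := h
    exact hi (hasIrreducibleModPGaloisRep_of_hasSurjectiveModNGaloisRep W p hs)
  -- emptySmallIm: irr ∧ ¬surj ∧ (im)
  · obtain ⟨hi, hns, him⟩ := h
    exact not_bigIm_of_irr_of_not_surj W p hi hns him
  -- emptySsRed: ss ∧ ¬irr ∧ p odd
  · obtain ⟨hss, hi, hodd⟩ := h
    exact hi (irr_of_goodSS hodd hss)
  -- emptySstIrrNonsurj: sst ∧ irr ∧ ¬surj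
  · obtain ⟨hs, hi, hns⟩ := h
    exact hns (surj_of_semistable_of_irr hs hi)
  -- C8
  · exact h
  -- C17
  · obtain ⟨hcm, h1, hodd, hsp⟩ := h
    exact ⟨hcm, hr1 h1, hodd, hsp⟩
  -- C9
  · obtain ⟨hcm, h1, hodd, hsp, hg⟩ := h
    exact ⟨hcm, hr1 h1, hodd, hsp, hg⟩
  -- C10
  · obtain ⟨hcm, h1, hodd, hin, hg⟩ := h
    exact ⟨hcm, hr1 h1, hodd, hin, hg⟩
  -- X12
  · obtain ⟨hcm, h1, hb⟩ := h
    refine ⟨hcm, hr1 h1, ?_⟩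
    rcases hb with h2 | ⟨h3, hns⟩ | ⟨hram, -⟩ | hng
    · exact Or.inl h2
    · subst h3
      exact Or.inr (Or.inl ⟨rfl, hns⟩)
    · exact Or.inr (Or.inr (Or.inl hram))
    · exact Or.inr (Or.inr (Or.inr hng))
  -- X5
  · exact h
  -- C1
  · obtain ⟨h0, hodd, hred, hi, hram⟩ := h
    refine ⟨h0, by omega, ?_, hi, hram⟩
    rcases hred with ho | hm
    · exact Or.inl ho
    · exact Or.inr hm.2
  -- C2
  · obtain ⟨hcm, h5, ho, hi, him⟩ := h
    exact ⟨hcm, by omega, ho, hi, him, hr⟩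
  -- C16
  · obtain ⟨hcm, hodd, ho, hi, him⟩ := h
    exact ⟨hcm, by omega, ho, hi, him, hr⟩
  -- C3
  · obtain ⟨h1, hs, hg, hi, hb⟩ := h
    refine ⟨hr1 h1, hs, hg, hi, ?_⟩
    rcases hb with h5 | ⟨h3, ho | hz⟩
    · exact Or.inl h5
    · exact Or.inr ⟨h3, Or.inl ho⟩
    · exact Or.inr ⟨h3, Or.inr hz⟩
  -- C6
  · obtain ⟨hodd, hi, hg, hna⟩ := h
    exact ⟨by omega, hi, hg, hna, hr⟩
  -- C7
  · obtain ⟨h0, hcm, hodd, ho, hi, hgv⟩ := h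
    exact ⟨h0, hcm, hodd, ho, hi, hgv⟩
  -- X3
  · exact h
  -- X4
  · exact h
  -- X2
  · obtain ⟨hodd, hi, -, hm⟩ := h
    exact ⟨hodd, hi, hm⟩
  -- X1
  · obtain ⟨hodd, hi, hg, ha, hngv⟩ := h
    exact ⟨by omega, hi, hg, ha, hngv⟩
  -- X8
  · obtain ⟨h3, hss, hz⟩ := h
    subst h3
    exact ⟨rfl, hss, hz⟩
  -- X7
  · exact h
  -- X6
  · exact h
  -- X9
  · obtain ⟨hcm, ho, h5, hi, hns, hb⟩ := h
    refine ⟨hcm, ho, h5, hi, hns, fun h1 => ?_⟩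
    rcases hb with h0 | hnss
    · omega
    · exact hnss
  -- X10
  · obtain ⟨h3, ho, hi, hb⟩ := h
    subst h3
    refine ⟨rfl, ho, hi, ?_⟩
    rcases hb with ⟨h0, hnr⟩ | ⟨h1, hns⟩
    · exact Or.inl ⟨h0, hnr⟩
    · exact Or.inr ⟨hr1 h1, hns⟩
  -- X11
  · obtain ⟨-, hm, hi, hb⟩ := h
    refine ⟨hm, hi, ?_⟩
    rcases hb with hnr | ⟨h1, hns⟩ | ⟨h1, h3⟩
    · exact Or.inl hnr
    · exact Or.inr (Or.inl ⟨hr1 h1, hns⟩)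
    · exact Or.inr (Or.inr ⟨hr1 h1, h3⟩)
  -- newFormerC4
  · obtain ⟨h1, -, hm, hi, hs, hram, h5⟩ := h
    exact ⟨hr1 h1, hm, hi, hs, hram, h5⟩
  -- emptyLitSerre
  · obtain ⟨hs, h5, him⟩ := h
    exact ⟨h5, hs, him⟩


/-- Real-curve form of the new region: if the cell of `(E, p)` is sent to `newFormerC4` then
`(E, p)` is in the former C4 domain. -/
theorem formerC4_of_classify_eq (hr : W.analyticRank ≤ 1)
    (h : classify (cellOf W p) = .newFormerC4) :
    W.analyticRank = 1 ∧ Mult W p ∧ Irr W p ∧ Semistable W ∧ Ram W p ∧ 5 ≤ p := by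
  have hs := spec_classify (cellOf W p)
  rw [h] at hs
  exact holds_of_spec (W := W) (p := p) hr .newFormerC4 hs


end Summit.BirchSwinnertonDyer.BirchSwinnertonDyer.Rank1Residual.Partition

end
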